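import Mathlib
import HarnessLib

/-!
# Cameron–Psarrakos (2019), display (6) `z₊(P) ≤ n·α(P)` — the integer counterexample at `n = 2`, `α(P) = 2`

Source: T. R. Cameron and P. J. Psarrakos, *On Descartes' rule of signs for matrix polynomials*, Operators and
Matrices **13** (2019) 643–652, doi:10.7153/oam-2019-13-48 [CameronPsarrakos2019]: p. 644 (the class `S` of
self-adjoint `n × n` matrix polynomials `P(λ) = Σ λⁱ Aᵢ` whose coefficients are each positive definite, negative
definite or null; `α(P)` = number of sign alternations of the definite coefficient sequence, null coefficients
ignored; `z₊(P)` = number of positive real eigenvalues = positive real roots of `det P`), display (6)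
`z₊(P) ≤ n · α(P)`, and p. 646: "We conjecture that (6), in fact, holds for all matrix polynomials in S."  Proved
there for `α ∈ {0, 1, m}` (Lemma 6), hyperbolic `P` (Thm 3), congruence-diagonalizable `P` (Prop. 4) and degree
`≤ 3` (Thm 7).  CATEGORY: an explicitly stated conjecture, REFUTED by an explicit integer witness at `n = 2`,
`α(P) = 2`: `P(t) = C₀ + t⁶C₆ + t⁷C₇ + t⁸C₈ + t¹⁵C₁₅` with `C₀, C₆, C₈, C₁₅ ≻ 0`, `C₇ ≺ 0` integer symmetric
(`Cₐ = 10⁶·Σ_{deg vₖ = a} vₖvₖᵀ + I`, `C₇ = −(10⁶·wwᵀ + I)`, `v = ((16,−74),(−74,282),(−17,−19),(−83,81),(−48,13))`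
at degrees `(0,6,8,8,15)`, `w = (0,200)`), whose determinant takes the signs `+ − + − + − +` at
`t = 1/8, 1/4, 1/2, 1, 2, 4, 8` (exact rational arithmetic), so by the intermediate value theorem `det P` has at
least SIX distinct positive real roots: `z₊(P) ≥ 6 > 4 = n·α(P)`.

This module: the folklore lemmas `le_card_posRoots_of_alternating` (sign alternation along an increasing positive
sequence ⇒ that many distinct positive roots, IVT) and `eval_det_pencil`; the witness `V`, `w`, `Cpos`, `J`, `P`;
definiteness `Cpos_posDef`, `neg_J_posDef`; `eval_det_P` (the determinant as an explicit polynomial), the seven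
sign evaluations `alt`, `six_le_card_posRoots_P`, **`cameronPsarrakos_counterexample`** (existential form over the five
coefficients), the instance statement `CameronPsarrakosRule22` (a cited definition — tombstone — refuted by
`cameronPsarrakosRule22_false`; no `_holds` can exist).  The print-generality statement (all sizes, degrees, sign
patterns; real and complex Hermitian coefficients) and its negation are in `Literature.LinearAlgebra.MatrixPolynomials.CameronPsarrakos2019.General`.

Provenance: refutations bundle `papers/_cross/refutations` (H21 seat pub-refute-2, 2026-08-18), package modules
`Refutations.CameronPsarrakos` and `Refutations.CameronPsarrakosGeneral`, moved into the tree under the Lean-in-tree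
rule (human 2026-08-18).  DUPLICATION NOTE for the operator: the witness module was itself VENDORED FROM THIS TREE —
`Summits/ValiantsHypothesis/ValiantsHypothesis/Theorems/LacunarySymmetroidMatrixDescartesDefiniteWitness.lean` (decl
`…LacunarySymmetroidMatrixDescartes.cameronPsarrakos_counterexample`, found by a Valiant-side route), with the two
folklore lemmas it imports (`le_card_posRoots_of_alternating` from `…/SymmetroidDescartesRolleToDescartes.lean`,
`eval_det_pencil` from `…/LacunarySymmetroidMatrixDescartesStubReverse.lean`) inlined; a Literature file
cannot have `Summits.*` imports, so this is a re-homing of a refutation of a PUBLISHED statement to where such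
reproductions live, and the Summits files could be re-pointed at it.  Renamed from the bundle: `CameronPsarrakosConjecture ↦
CameronPsarrakosRule`, `cameronPsarrakosConjecture_real_false ↦ cameronPsarrakosRule_real_false`,
`cameronPsarrakosConjecture_complex_false ↦ cameronPsarrakosRule_complex_false`.
-/

namespace Literature.LinearAlgebra.MatrixPolynomials.CameronPsarrakos2019

open scoped BigOperators Matrix
open Polynomial

/-! ### Two folklore lemmas (inlined from the tree) -/

/-- If a real polynomial `p` satisfies `p(τ j) · p(τ (j+1)) < 0` along a strictly increasing positive
sequence `τ 0 < … < τ N`, then `p` has at least `N` distinct positive roots (one in each gap, by the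
intermediate value theorem). [folklore] -/
theorem le_card_posRoots_of_alternating (p : ℝ[X]) (N : ℕ) (τ : Fin (N + 1) → ℝ)
    (hτ : StrictMono τ) (hpos : ∀ j, 0 < τ j)
    (halt : ∀ j : Fin N, p.eval (τ j.castSucc) * p.eval (τ j.succ) < 0) :
    N ≤ (p.roots.toFinset.filter (fun t => 0 < t)).card := by
  have hroot : ∀ j : Fin N, ∃ r, τ j.castSucc < r ∧ r < τ j.succ ∧ p.IsRoot r := by
    intro j
    have hlt : τ j.castSucc < τ j.succ := hτ (by exact Fin.castSucc_lt_succ)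
    have hcont : ContinuousOn (fun x => p.eval x) (Set.Icc (τ j.castSucc) (τ j.succ)) :=
      p.continuous.continuousOn
    rcases mul_neg_iff.1 (halt j) with ⟨h1, h2⟩ | ⟨h1, h2⟩
    · obtain ⟨r, ⟨hr1, hr2⟩, hr⟩ := intermediate_value_Ioo' hlt.le hcont ⟨h2, h1⟩
      exact ⟨r, hr1, hr2, hr⟩
    · obtain ⟨r, ⟨hr1, hr2⟩, hr⟩ := intermediate_value_Ioo hlt.le hcont ⟨h1, h2⟩
      exact ⟨r, hr1, hr2, hr⟩
  choose r hr₁ hr₂ hr₃ using hroot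
  have hmono : StrictMono r := by
    intro i j hij
    have hij' : (i : ℕ) < j := hij
    calc r i < τ i.succ := hr₂ i
      _ ≤ τ j.castSucc := hτ.monotone (by
          rw [Fin.le_def, Fin.val_succ, Fin.val_castSucc]
          exact hij')
      _ < r j := hr₁ j
  calc N = (Finset.univ : Finset (Fin N)).card := by simp
    _ ≤ (p.roots.toFinset.filter (fun t => 0 < t)).card := by
      refine Finset.card_le_card_of_injOn r (fun j _ => ?_) hmono.injective.injOn
      have hp : p ≠ 0 := by
        rintro rfl
        exact (lt_irrefl (0 : ℝ)) (by simpa using halt j)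
      simp only [Finset.mem_coe, Finset.mem_filter, Multiset.mem_toFinset, Polynomial.mem_roots hp]
      exact ⟨hr₃ j, (hpos _).trans (hr₁ j)⟩

/-- Evaluating the determinant of the polynomial pencil `X^e • J + ∑ₖ X^{dₖ} • Pₖ` at a real point
`t` gives the determinant of the real matrix `t^e • J + ∑ₖ t^{dₖ} • Pₖ` (`det` commutes with the
evaluation ring homomorphism). [folklore] -/
theorem eval_det_pencil {ι κ : Type} [Fintype ι] [DecidableEq ι] [Fintype κ]
    (e : ℕ) (d : κ → ℕ) (J : Matrix ι ι ℝ) (P : κ → Matrix ι ι ℝ) (t : ℝ) :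
    (Matrix.det (((Polynomial.X : Polynomial ℝ) ^ e) • J.map Polynomial.C
        + ∑ k, ((Polynomial.X : Polynomial ℝ) ^ d k) • (P k).map Polynomial.C)).eval t
      = Matrix.det (t ^ e • J + ∑ k, t ^ d k • P k) := by
  have h := RingHom.map_det (Polynomial.evalRingHom t)
    (((Polynomial.X : Polynomial ℝ) ^ e) • J.map Polynomial.C
        + ∑ k, ((Polynomial.X : Polynomial ℝ) ^ d k) • (P k).map Polynomial.C)
  rw [Polynomial.coe_evalRingHom] at h
  rw [h]
  congr 1
  ext i j
  simp only [RingHom.mapMatrix_apply, Matrix.map_apply, Matrix.add_apply, Matrix.smul_apply,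
    Matrix.sum_apply, smul_eq_mul, Polynomial.coe_evalRingHom, Polynomial.eval_add,
    Polynomial.eval_mul, Polynomial.eval_pow, Polynomial.eval_X, Polynomial.eval_C,
    Polynomial.eval_finsetSum]

/-! ### The witness -/

/-- the five integer vectors `vₖ` [folklore] -/
def V : Fin 5 → Fin 2 → ℝ := ![![16, -74], ![-74, 282], ![-17, -19], ![-83, 81], ![-48, 13]]

/-- the vector `w = (0, 200)` of the negative definite letter [folklore] -/
def w : Fin 2 → ℝ := ![0, 200]

/-- the four POSITIVE DEFINITE coefficients `10⁶·Σ_{deg vₖ = a} vₖvₖᵀ + I` at degrees `0, 6, 8, 15`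
(the degree-8 coefficient carries the two vectors `v₂, v₃`) [folklore] -/
def Cpos : Fin 4 → Matrix (Fin 2) (Fin 2) ℝ :=
  ![(1000000 : ℝ) • Matrix.vecMulVec (V 0) (V 0) + 1,
    (1000000 : ℝ) • Matrix.vecMulVec (V 1) (V 1) + 1,
    (1000000 : ℝ) • (Matrix.vecMulVec (V 2) (V 2) + Matrix.vecMulVec (V 3) (V 3)) + 1,
    (1000000 : ℝ) • Matrix.vecMulVec (V 4) (V 4) + 1]

/-- their degrees `(0, 6, 8, 15)` [folklore] -/
def dpos : Fin 4 → ℕ := ![0, 6, 8, 15]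

/-- the NEGATIVE DEFINITE coefficient `C₇ = −(10⁶·wwᵀ + I)` at degree `7` [folklore] -/
def J : Matrix (Fin 2) (Fin 2) ℝ := -((1000000 : ℝ) • Matrix.vecMulVec w w + 1)

/-- the degree `7` of the negative definite coefficient [folklore] -/
def e : ℕ := 7

/-- the witness `P(X) = X^7 • C₇ + ∑ₖ X^{dₖ} • Cₖ` as a polynomial matrix [folklore] -/
noncomputable def P : Matrix (Fin 2) (Fin 2) ℝ[X] :=
  ((X : ℝ[X]) ^ e) • J.map Polynomial.C + ∑ k, ((X : ℝ[X]) ^ dpos k) • (Cpos k).map Polynomial.C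

/-- `vvᵀ` is positive semidefinite over `ℝ` [folklore] -/
theorem posSemidef_vecMulVec_self (v : Fin 2 → ℝ) : (Matrix.vecMulVec v v).PosSemidef := by
  have h := Matrix.posSemidef_vecMulVec_self_star (R := ℝ) v
  rwa [star_trivial] at h

/-- every `Cₖ` (`k = 0, 6, 8, 15`) is positive definite [folklore] -/
theorem Cpos_posDef (k : Fin 4) : (Cpos k).PosDef := by
  have h1 : ∀ v : Fin 2 → ℝ, ((1000000 : ℝ) • Matrix.vecMulVec v v + 1).PosDef := fun v =>
    Matrix.PosDef.posSemidef_add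
      ((posSemidef_vecMulVec_self v).smul (by norm_num : (0 : ℝ) ≤ 1000000)) Matrix.PosDef.one
  have h2 : ∀ v v' : Fin 2 → ℝ,
      ((1000000 : ℝ) • (Matrix.vecMulVec v v + Matrix.vecMulVec v' v') + 1).PosDef := fun v v' =>
    Matrix.PosDef.posSemidef_add
      (((posSemidef_vecMulVec_self v).add (posSemidef_vecMulVec_self v')).smul
        (by norm_num : (0 : ℝ) ≤ 1000000)) Matrix.PosDef.one
  fin_cases k
  · exact h1 _
  · exact h1 _
  · exact h2 _ _
  · exact h1 _

/-- `C₇` is negative definite (`−C₇ ≻ 0`) [folklore] -/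
theorem neg_J_posDef : (-J).PosDef := by
  unfold J
  rw [neg_neg]
  exact Matrix.PosDef.posSemidef_add
    ((posSemidef_vecMulVec_self w).smul (by norm_num : (0 : ℝ) ≤ 1000000)) Matrix.PosDef.one

/-- the integer entries of the five coefficients, as displayed in the module docstring [folklore] -/
theorem coefficients_eq :
    Cpos 0 = !![256000001, -1184000000; -1184000000, 5476000001] ∧
    Cpos 1 = !![5476000001, -20868000000; -20868000000, 79524000001] ∧
    J = !![-1, 0; 0, -40000000001] ∧
    Cpos 2 = !![7178000001, -6400000000; -6400000000, 6922000001] ∧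
    Cpos 3 = !![2304000001, -624000000; -624000000, 169000001] := by
  refine ⟨?_, ?_, ?_, ?_, ?_⟩ <;>
  · ext i j
    fin_cases i <;> fin_cases j <;> simp [Cpos, J, V, w, Matrix.vecMulVec] <;> norm_num

/-- `det P(t)` in closed form [folklore] -/
theorem eval_det_P (t : ℝ) :
    (P.det).eval t =
      (256000001 + 5476000001 * t ^ 6 - t ^ 7 + 7178000001 * t ^ 8 + 2304000001 * t ^ 15) *
          (5476000001 + 79524000001 * t ^ 6 - 40000000001 * t ^ 7 + 6922000001 * t ^ 8 + 169000001 * t ^ 15) -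
        (-1184000000 - 20868000000 * t ^ 6 - 6400000000 * t ^ 8 - 624000000 * t ^ 15) ^ 2 := by
  unfold P
  rw [eval_det_pencil]
  simp [Matrix.det_fin_two, Fin.sum_univ_four, Cpos, V, J, w, dpos, e]
  ring

/-- seven positive dyadic test points [folklore] -/
noncomputable def τ : Fin 7 → ℝ := ![1/8, 1/4, 1/2, 1, 2, 4, 8]

/-- Auxiliary lemma: `: StrictMono τ`. [folklore] -/
theorem τ_strictMono : StrictMono τ := by
  refine Fin.strictMono_iff_lt_succ.2 fun j => ?_
  fin_cases j <;> simp [τ] <;> norm_num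

/-- Auxiliary lemma: `(j : Fin 7) : 0 < τ j`. [folklore] -/
theorem τ_pos (j : Fin 7) : 0 < τ j := by
  fin_cases j <;> simp [τ]

/-- `det P` alternates in sign along the test points (signs `+,−,+,−,+,−,+`; `norm_num` certificate) [folklore] -/
theorem alt (j : Fin 6) : (P.det).eval (τ j.castSucc) * (P.det).eval (τ j.succ) < 0 := by
  fin_cases j <;> simp only [eval_det_P, τ] <;> simp <;> norm_num

/-- **`z₊(P) ≥ 6`**: `det P` has at least six distinct positive real roots. [folklore] -/
theorem six_le_card_posRoots_P : 6 ≤ (P.det.roots.toFinset.filter (fun t => 0 < t)).card :=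
  le_card_posRoots_of_alternating _ 6 τ τ_strictMono τ_pos alt

/-- **Counterexample to the Cameron–Psarrakos rule (6)** [Oper. Matrices 13 (2019), display (6):
`z₊(P) ≤ n·α(P)` for every self-adjoint matrix polynomial whose coefficients are positive definite,
negative definite or null].  There are real symmetric `2 × 2` matrices `C₀, C₆, C₈, C₁₅ ≻ 0` and `C₇ ≺ 0`
such that `P(t) = C₀ + t⁶C₆ + t⁷C₇ + t⁸C₈ + t¹⁵C₁₅` — two sign alternations, `n·α(P) = 2·2 = 4` — has
MORE than `4` (indeed at least `6`) distinct positive real eigenvalues. [cite: CameronPsarrakos2019, display (6) p. 644] -/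
theorem cameronPsarrakos_counterexample :
    ∃ (C₀ C₆ C₇ C₈ C₁₅ : Matrix (Fin 2) (Fin 2) ℝ),
      C₀.PosDef ∧ C₆.PosDef ∧ (-C₇).PosDef ∧ C₈.PosDef ∧ C₁₅.PosDef ∧
        2 * 2 < ((Matrix.det (C₀.map Polynomial.C + ((X : ℝ[X]) ^ 6) • C₆.map Polynomial.C
            + ((X : ℝ[X]) ^ 7) • C₇.map Polynomial.C + ((X : ℝ[X]) ^ 8) • C₈.map Polynomial.C
            + ((X : ℝ[X]) ^ 15) • C₁₅.map Polynomial.C)).roots.toFinset.filter (fun t => 0 < t)).card := by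
  refine ⟨Cpos 0, Cpos 1, J, Cpos 2, Cpos 3, Cpos_posDef 0, Cpos_posDef 1, neg_J_posDef,
    Cpos_posDef 2, Cpos_posDef 3, ?_⟩
  have hP : (Cpos 0).map Polynomial.C + ((X : ℝ[X]) ^ 6) • (Cpos 1).map Polynomial.C
      + ((X : ℝ[X]) ^ 7) • J.map Polynomial.C + ((X : ℝ[X]) ^ 8) • (Cpos 2).map Polynomial.C
      + ((X : ℝ[X]) ^ 15) • (Cpos 3).map Polynomial.C = P := by
    unfold P
    simp only [Fin.sum_univ_four, dpos, e]
    simp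
    abel
  rw [hP]
  exact lt_of_lt_of_le (by norm_num) six_le_card_posRoots_P

/-- The same statement with the universally quantified rule spelled out and negated:
it is NOT the case that every `2 × 2` self-adjoint real matrix polynomial of the shape
`C₀ + t⁶C₆ + t⁷C₇ + t⁸C₈ + t¹⁵C₁₅` with `C₀, C₆, C₈, C₁₅ ≻ 0`, `C₇ ≺ 0` (so `α = 2`) has at most
`n·α = 4` distinct positive real eigenvalues. [folklore] -/
theorem not_matrixDescartes_two_two :
    ¬ ∀ (C₀ C₆ C₇ C₈ C₁₅ : Matrix (Fin 2) (Fin 2) ℝ),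
      C₀.PosDef → C₆.PosDef → (-C₇).PosDef → C₈.PosDef → C₁₅.PosDef →
        ((Matrix.det (C₀.map Polynomial.C + ((X : ℝ[X]) ^ 6) • C₆.map Polynomial.C
            + ((X : ℝ[X]) ^ 7) • C₇.map Polynomial.C + ((X : ℝ[X]) ^ 8) • C₈.map Polynomial.C
            + ((X : ℝ[X]) ^ 15) • C₁₅.map Polynomial.C)).roots.toFinset.filter (fun t => 0 < t)).card
          ≤ 2 * 2 := by
  intro h
  obtain ⟨C₀, C₆, C₇, C₈, C₁₅, h₀, h₆, h₇, h₈, h₁₅, hlt⟩ := cameronPsarrakos_counterexample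
  exact absurd (h C₀ C₆ C₇ C₈ C₁₅ h₀ h₆ h₇ h₈ h₁₅) (not_le.mpr hlt)

/-- ONE INSTANCE of the Cameron–Psarrakos rule `z₊(P) ≤ n·α(P)` (display (6)): size `n = 2`, support
`{0, 6, 7, 8, 15}`, sign pattern `+ + − + +` (so `α(P) = 2`): every `2 × 2` real matrix polynomial
`C₀ + t⁶C₆ + t⁷C₇ + t⁸C₈ + t¹⁵C₁₅` with `C₀, C₆, C₈, C₁₅ ≻ 0` and `C₇ ≺ 0` has at most `2·2 = 4` DISTINCT positive real
eigenvalues.  Conventions: Mathlib's `Matrix.PosDef` includes `IsHermitian`, so every coefficient is symmetric and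
`P ∈ S` in the authors' sense; display (6) counts `z₊(P)` WITH multiplicity, we count distinct positive roots of
`det P` — the weaker count, so `> 4` distinct roots refutes (6) in either reading.  **REFUTED in this file:**
`cameronPsarrakosRule22_false`; the statement in print generality is `CameronPsarrakosRule` (module `General`). [cite: CameronPsarrakos2019, display (6) p. 644, p. 646] -/
def CameronPsarrakosRule22 : Prop :=
  ∀ (C₀ C₆ C₇ C₈ C₁₅ : Matrix (Fin 2) (Fin 2) ℝ),
    C₀.PosDef → C₆.PosDef → (-C₇).PosDef → C₈.PosDef → C₁₅.PosDef →
      ((Matrix.det (C₀.map Polynomial.C + ((X : ℝ[X]) ^ 6) • C₆.map Polynomial.C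
          + ((X : ℝ[X]) ^ 7) • C₇.map Polynomial.C + ((X : ℝ[X]) ^ 8) • C₈.map Polynomial.C
          + ((X : ℝ[X]) ^ 15) • C₁₅.map Polynomial.C)).roots.toFinset.filter (fun t => 0 < t)).card
        ≤ 2 * 2

/-- **The Cameron–Psarrakos matrix Descartes rule (6) is false** (at `n = 2`, `α = 2`). [folklore] -/
theorem cameronPsarrakosRule22_false : ¬ CameronPsarrakosRule22 :=
  not_matrixDescartes_two_two

end Literature.LinearAlgebra.MatrixPolynomials.CameronPsarrakos2019
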